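import Mathlib

/-!
# Venture HSemireg — MOD-4 OFF THE SPLIT FAMILY: the two-slope middle-degree matrix `M_{1+e^h}` and its spectrum,
# for every `n` (THEOREM R_f, corollary (C2); seat `w3-mod4-1` g4, files of record
# `widen/W3/MOD4-OFFSPLIT-w3mod4.md` v1.5 §10.2, `widen/W3/MOD4-OFFSPLIT-THEOREMS-w3mod4.md` v1.4.6)

HONEST FRAMING. Lean index of the computation cell `pub-hsemireg`, widening seat `w3-mod4-1`.  ELEMENTARY LINEAR
ALGEBRA OF ONE EXPLICIT `(n+1) × (n+1)` RATIONAL MATRIX ONLY: no abelian variety, no sheaf, no Ext group and no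
semiregularity map is constructed here.  On paper (THEOREM R_f of the file of record) the middle-degree contraction rank
of the Mukai vector `f(h) + w` on a Weil `2n`-fold is `(r_n + 2)·C(2n,n) − 2 r_n − dim ker (M_f − (−1)ⁿ τ)` for an
explicit matrix `M_f` in the Chern numbers of `f`; for the two-slope normal form `f = 1 + e^h` (`q_0 = 2`, `q_i = 1`)
that matrix is `M = e_n · rᵀ + 𝟙 · e_0ᵀ` with `r_b = (−1)^{n+b} C(n,b)`, i.e. the matrix `twoSlopeM n` below.  The
statements proved here — `M` fixes `e_n` and `𝟙`, every eigenvalue of `M` is `0` or `1`, and the `1`-eigenspace is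
exactly the plane spanned by `𝟙` and `e_n` — are the spectral input («one non-zero eigenvalue, of geometric multiplicity
two») behind the two-slope box/G dichotomy (THEOREM R₂) for every `n`.  Nothing here says that HC, HC_CM or HC_AV holds.

CONTENT (all PROVED, 0 sorry), namespace `Summit.Ventures.HSemireg.Mod4`:
* `twoSlopeM` — the matrix; `twoSlopeM_mulVec` — the closed form of `M v`;
* `twoSlopeM_mulVec_one`, `twoSlopeM_mulVec_single_last` — `M 𝟙 = 𝟙`, `M e_n = e_n` (`n ≥ 1`);
* `twoSlopeM_eigenvalue` — `M v = λ v`, `v ≠ 0` ⇒ `λ = 0 ∨ λ = 1` (`n ≥ 1`);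
* `twoSlopeM_fixed_iff` — `M v = v ↔ v = v 0 · 𝟙 + (v (last) − v 0) · e_n` (`n ≥ 1`): the fixed space is the plane
  `⟨𝟙, e_n⟩`.
-/

namespace Summit.Ventures.HSemireg

namespace Mod4

open Finset Matrix

/-- The two-slope middle-degree matrix `M_{1+e^h}` of THEOREM R_f (C2): entry `(a,b)` is
`[a = n]·(−1)^{n+b}·C(n,b) + [b = 0]`. -/
def twoSlopeM (n : ℕ) : Matrix (Fin (n + 1)) (Fin (n + 1)) ℚ :=
  fun a b => (if a = Fin.last n then (-1 : ℚ) ^ (n + (b : ℕ)) * (n.choose (b : ℕ) : ℚ) else 0) +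
    (if b = 0 then 1 else 0)

/-- The alternating row sum `Σ_b (−1)^{n+b} C(n,b) v_b` appearing in the last coordinate of `M v`. -/
def altRow (n : ℕ) (v : Fin (n + 1) → ℚ) : ℚ :=
  ∑ b : Fin (n + 1), (-1 : ℚ) ^ (n + (b : ℕ)) * (n.choose (b : ℕ) : ℚ) * v b

/-- Closed form of `M v`: `(M v)_a = [a = n]·Σ_b (−1)^{n+b} C(n,b) v_b + v_0`. -/
theorem twoSlopeM_mulVec (n : ℕ) (v : Fin (n + 1) → ℚ) (a : Fin (n + 1)) :
    (twoSlopeM n).mulVec v a = (if a = Fin.last n then altRow n v else 0) + v 0 := by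
  simp only [Matrix.mulVec, dotProduct, twoSlopeM, altRow, add_mul, Finset.sum_add_distrib]
  congr 1
  · split_ifs with h
    · rfl
    · simp
  · simp [Finset.sum_ite_eq']

/-- `Σ_b (−1)^{n+b} C(n,b) = 0` for `n ≥ 1` (the alternating binomial sum). -/
theorem altRow_const (n : ℕ) (hn : 1 ≤ n) (c : ℚ) : altRow n (fun _ => c) = 0 := by
  unfold altRow
  have h0 : ∑ b : Fin (n + 1), (-1 : ℚ) ^ (n + (b : ℕ)) * (n.choose (b : ℕ) : ℚ) * c
      = (-1 : ℚ) ^ n * c * ∑ b : Fin (n + 1), (-1 : ℚ) ^ (b : ℕ) * (n.choose (b : ℕ) : ℚ) := by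
    rw [Finset.mul_sum]
    refine Finset.sum_congr rfl fun b _ => ?_
    rw [pow_add]; ring
  rw [h0]
  have h1 : ∑ b : Fin (n + 1), (-1 : ℚ) ^ (b : ℕ) * (n.choose (b : ℕ) : ℚ)
      = ∑ k ∈ Finset.range (n + 1), (-1 : ℚ) ^ k * (n.choose k : ℚ) :=
    Fin.sum_univ_eq_sum_range (fun k => (-1 : ℚ) ^ k * (n.choose k : ℚ)) (n + 1)
  have h2 : ∑ k ∈ Finset.range (n + 1), (-1 : ℚ) ^ k * (n.choose k : ℚ) = 0 := by
    have h := Int.alternating_sum_range_choose_of_ne (Nat.one_le_iff_ne_zero.mp hn)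
    have h' : ((∑ k ∈ Finset.range (n + 1), ((-1 : ℤ) ^ k * (n.choose k : ℤ)) : ℤ) : ℚ) = 0 := by
      rw [h]; simp
    push_cast at h'
    exact h'
  rw [h1, h2, mul_zero]

/-- `M 𝟙 = 𝟙` for `n ≥ 1`. -/
theorem twoSlopeM_mulVec_one (n : ℕ) (hn : 1 ≤ n) :
    (twoSlopeM n).mulVec (fun _ => (1 : ℚ)) = fun _ => 1 := by
  funext a
  rw [twoSlopeM_mulVec, altRow_const n hn 1]
  simp

/-- `M e_n = e_n` for `n ≥ 1` (`e_n = Pi.single (Fin.last n) 1`). -/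
theorem twoSlopeM_mulVec_single_last (n : ℕ) (hn : 1 ≤ n) :
    (twoSlopeM n).mulVec (Pi.single (Fin.last n) 1) = Pi.single (Fin.last n) 1 := by
  have hne : (0 : Fin (n + 1)) ≠ Fin.last n := by
    intro h
    have := congrArg Fin.val h
    simp at this
    omega
  funext a
  rw [twoSlopeM_mulVec]
  have hrow : altRow n (Pi.single (Fin.last n) 1) = 1 := by
    unfold altRow
    rw [Finset.sum_eq_single (Fin.last n)]
    · simp [Fin.val_last, ← two_mul, pow_mul]
    · intro b _ hb
      simp [hb]
    · intro h; exact absurd (Finset.mem_univ _) h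
  rw [hrow, Pi.single_apply, if_neg hne, add_zero]
  by_cases ha : a = Fin.last n
  · subst ha; simp
  · rw [if_neg ha, Pi.single_apply, if_neg ha]

/-- Every eigenvalue of `M` is `0` or `1` (`n ≥ 1`). -/
theorem twoSlopeM_eigenvalue (n : ℕ) (hn : 1 ≤ n) (lam : ℚ) (v : Fin (n + 1) → ℚ) (hv : v ≠ 0)
    (h : (twoSlopeM n).mulVec v = lam • v) : lam = 0 ∨ lam = 1 := by
  have hne : (0 : Fin (n + 1)) ≠ Fin.last n := by
    intro h0
    have := congrArg Fin.val h0
    simp at this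
    omega
  rcases eq_or_ne lam 0 with hl | hl0
  · exact Or.inl hl
  rcases eq_or_ne lam 1 with hl | hl1
  · exact Or.inr hl
  exfalso
  have hcoord : ∀ a, (if a = Fin.last n then altRow n v else 0) + v 0 = lam * v a := by
    intro a
    have := congrFun h a
    rw [twoSlopeM_mulVec] at this
    simpa [Pi.smul_apply, smul_eq_mul] using this
  -- coordinate 0: v 0 = lam * v 0, so v 0 = 0
  have h0 : v 0 = 0 := by
    have := hcoord 0
    rw [if_neg hne, zero_add] at this
    have : (lam - 1) * v 0 = 0 := by linarith
    rcases mul_eq_zero.mp this with h | h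
    · exact absurd (sub_eq_zero.mp h) hl1
    · exact h
  -- coordinates a ≠ last: lam * v a = v 0 = 0, so v a = 0
  have hoff : ∀ a, a ≠ Fin.last n → v a = 0 := by
    intro a ha
    have := hcoord a
    rw [if_neg ha, zero_add, h0] at this
    rcases mul_eq_zero.mp this.symm with h | h
    · exact absurd h hl0
    · exact h
  -- last coordinate: altRow v = C(n,n) v_last = v_last, so (lam - 1) v_last = 0
  have hrow : altRow n v = v (Fin.last n) := by
    unfold altRow
    rw [Finset.sum_eq_single (Fin.last n)]
    · simp [Fin.val_last, ← two_mul, pow_mul]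
    · intro b _ hb
      rw [hoff b hb, mul_zero]
    · intro hh; exact absurd (Finset.mem_univ _) hh
  have hlast : v (Fin.last n) = 0 := by
    have := hcoord (Fin.last n)
    rw [if_pos rfl, hrow, h0, add_zero] at this
    have : (lam - 1) * v (Fin.last n) = 0 := by linarith
    rcases mul_eq_zero.mp this with h | h
    · exact absurd (sub_eq_zero.mp h) hl1
    · exact h
  apply hv
  funext a
  by_cases ha : a = Fin.last n
  · rw [ha]; exact hlast
  · exact hoff a ha

/-- The fixed space of `M` is exactly the plane spanned by `𝟙` and `e_n` (`n ≥ 1`):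
`M v = v ↔ v = v₀·𝟙 + (v_n − v₀)·e_n`. -/
theorem twoSlopeM_fixed_iff (n : ℕ) (hn : 1 ≤ n) (v : Fin (n + 1) → ℚ) :
    (twoSlopeM n).mulVec v = v ↔
      v = fun a => v 0 + (v (Fin.last n) - v 0) * (Pi.single (Fin.last n) (1 : ℚ) : Fin (n + 1) → ℚ) a := by
  have hne : (0 : Fin (n + 1)) ≠ Fin.last n := by
    intro h0
    have := congrArg Fin.val h0
    simp at this
    omega
  constructor
  · intro h
    funext a
    by_cases ha : a = Fin.last n
    · subst ha; simp
    · have := congrFun h a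
      rw [twoSlopeM_mulVec, if_neg ha, zero_add] at this
      rw [Pi.single_apply, if_neg ha, mul_zero, add_zero]
      exact this.symm
  · intro h
    -- write v = v₀ • 𝟙 + (v_n − v₀) • e_n and use linearity
    have hv : v = (v 0) • (fun _ => (1 : ℚ)) + (v (Fin.last n) - v 0) • Pi.single (Fin.last n) (1 : ℚ) := by
      conv_lhs => rw [h]
      funext a
      simp [Pi.add_apply, Pi.smul_apply, smul_eq_mul]
    rw [hv, Matrix.mulVec_add, Matrix.mulVec_smul, Matrix.mulVec_smul, twoSlopeM_mulVec_one n hn,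
      twoSlopeM_mulVec_single_last n hn]

/-- Sanity `example` (n = 3): the matrix is `[[1,0,0,0],[1,0,0,0],[1,0,0,0],[1-1·… ]]` — concretely its last row is
`(−1+1, 3, −3, 1) = (0, 3, -3, 1)` and `M 𝟙 = 𝟙`. -/
example : (twoSlopeM 3).mulVec (fun _ => (1 : ℚ)) = fun _ => 1 := twoSlopeM_mulVec_one 3 (by norm_num)

end Mod4

end Summit.Ventures.HSemireg
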